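import Summits.CriticalPhenomena.Ising3DConformalLimit.Theorems.EnergyNotSigmaSquaredGapForcesFarMergingScreeningDefs
import Literature.Probability.LatticeModels.IntersectionSecondMoment
import Literature.Probability.LatticeModels.CurrentsPartialMonotonicity
import Literature.Probability.LatticeModels.WeightedCurrentsIdentities
import HarnessLib

/-!
# The hitting engine `HittingLowerBound` (stub `stub_hittingBound`)
(line `screening-form-lemma-a1` of the crux `GapForcesFarMerging`, item stmt-CriticalPhenomena-4468,
route `EnergyNotSigmaSquared`)

Proves `HittingLowerBound` of `Theorems/EnergyNotSigmaSquaredGapForcesFarMergingScreeningDefs.lean`: on a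
finite graph with couplings `K ≥ 0`, for the duplicated cluster `C(x) = C_{n₁+n₂}(x)` under the pair
weights `w(p) = 1{∂n₁ = {x}∆{y}} 1{∂n₂ = ∅} w(n₁) w(n₂)` and a deterministic obstacle `T`,
`(Σ_{s∈T} Z[xs]Z[sy])² · Z[∅] ≤ (Σ_{s,t∈T} B(s,t)) · Σ_p w(p) 𝟙[C(x) ∩ T ≠ ∅]`,
`B(s,t) = Z[xs]Z[st]Z[ty] + Z[xt]Z[ts]Z[sy]` — the Paley–Zygmund lower bound
`P^{xy,∅}[C(x) ∩ T ≠ ∅] ≥ E[N]²/E[N²]` for the hitting count `N = #(C(x) ∩ T) = Σ_{s∈T} 𝟙[s ∈ C(x)]`,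
cross-multiplied in `ℝ≥0∞` (no subtraction, no division).

Route (Aizenman–Duminil-Copin 2021, arXiv:1912.07973, §4.2 proof of Lemma 4.4 and Appendix A Prop. A.3,
here for ONE cluster against a fixed set): first moment EXACT by the one-point identity
`Current.tsum_epairWeight_mul_indicator_mem_cluster` (`Σ_p w 𝟙[s ∈ C(x)] = Z[ys]Z[xs]`); second moment by
Prop. A.3 `Current.ecurrentSum_empty_mul_tsum_double_conn_le` (`Z[∅] Σ_p w 𝟙[s∈C]𝟙[t∈C] ≤ B(s,t)`);
Cauchy–Schwarz `Current.tsum_mul_sq_le_tsum_indicator_mul_tsum_sq` (`(Σ w N)² ≤ (Σ w 𝟙[N≠0])(Σ w N²)`),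
with `𝟙[N ≠ 0] = 𝟙[¬ Disjoint T C(x)]`.

References: M. Aizenman, H. Duminil-Copin, Ann. of Math. 194 (2021), arXiv:1912.07973, §4.2 (proof of
Lemma 4.4) and Appendix A.2 (Proposition A.3).
-/

noncomputable section

namespace Summit.CriticalPhenomena.Ising3DConformalLimit.EnergyNotSigmaSquaredGapForcesFarMerging

open scoped symmDiff ENNReal
open Finset
open Literature.Probability.LatticeModels
open Summit.CriticalPhenomena.Ising3DConformalLimit.GapForcesFarMergingScreening

namespace HittingBound

variable {V : Type} [Fintype V] [DecidableEq V] {G : SimpleGraph V} [DecidableRel G.Adj]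
  {K : G.edgeFinset → ℝ}

/-- **First moment of the hitting count** (exact): with `N(p) = Σ_{s∈T} 𝟙[s ∈ C_{p₁+p₂}(x)]`,
`Σ_p 1{∂p₁={x,y}}1{∂p₂=∅} w w N(p) = Σ_{s∈T} Z[xs] Z[sy]` — the one-point identity
`P^{xy,∅}[s ∈ C(x)] = ⟨σ_xσ_s⟩⟨σ_sσ_y⟩/⟨σ_xσ_y⟩` summed over `s ∈ T`.
[cite: AizenmanDuminilCopinAnnals2021, arXiv:1912.07973 §4.2, proof of Lemma 4.4 (first moment of |𝓜|)] -/
theorem tsum_epairWeight_mul_count (hK : ∀ e, 0 ≤ K e) (x y : V) (T : Finset V) :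
    ∑' p : Current G × Current G, epairWeight K ({x} ∆ {y}) ∅ p *
        ∑ s ∈ T, (if s ∈ (p.1 + p.2).cluster x then (1 : ℝ≥0∞) else 0) =
      ∑ s ∈ T, ecurrentSum K ({x} ∆ {s}) * ecurrentSum K ({s} ∆ {y}) := by
  simp_rw [Finset.mul_sum]
  rw [Summable.tsum_finsetSum (fun _ _ => ENNReal.summable)]
  refine Finset.sum_congr rfl fun s _ => ?_
  rw [Current.tsum_epairWeight_mul_indicator_mem_cluster hK x y s, symmDiff_comm ({y} : Finset V) {s},
    mul_comm]

/-- `𝟙[N(p) ≠ 0] = 𝟙[C_{p₁+p₂}(x) ∩ T ≠ ∅]`: the hitting count vanishes iff the cluster misses `T`. [folklore] -/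
theorem indicator_count_ne_zero (x : V) (T : Finset V) (p : Current G × Current G) :
    (if (∑ s ∈ T, (if s ∈ (p.1 + p.2).cluster x then (1 : ℝ≥0∞) else 0)) = 0 then (0 : ℝ≥0∞) else 1) =
      if Disjoint T ((p.1 + p.2).cluster x) then 0 else 1 := by
  have hiff : (∑ s ∈ T, (if s ∈ (p.1 + p.2).cluster x then (1 : ℝ≥0∞) else 0)) = 0 ↔
      Disjoint T ((p.1 + p.2).cluster x) := by
    rw [Finset.sum_eq_zero_iff, Finset.disjoint_left]
    refine forall₂_congr fun s _ => ?_
    simp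
  by_cases h : Disjoint T ((p.1 + p.2).cluster x)
  · rw [if_pos (hiff.2 h), if_pos h]
  · rw [if_neg (fun h' => h (hiff.1 h')), if_neg h]

/-- **Second moment of the hitting count** (Proposition A.3 summed over pairs of obstacle sites):
`Z[∅] · Σ_p 1{∂p₁={x,y}}1{∂p₂=∅} w w N(p)² ≤ Σ_{s,t∈T} (Z[xs]Z[st]Z[ty] + Z[xt]Z[ts]Z[sy])`.
[cite: AizenmanDuminilCopinAnnals2021, arXiv:1912.07973 Appendix A.2, Proposition A.3] -/
theorem ecurrentSum_empty_mul_tsum_epairWeight_mul_count_sq_le (hK : ∀ e, 0 ≤ K e) (x y : V)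
    (T : Finset V) :
    ecurrentSum K ∅ * ∑' p : Current G × Current G, epairWeight K ({x} ∆ {y}) ∅ p *
        (∑ s ∈ T, (if s ∈ (p.1 + p.2).cluster x then (1 : ℝ≥0∞) else 0)) ^ 2 ≤
      ∑ s ∈ T, ∑ t ∈ T,
          (ecurrentSum K ({x} ∆ {s}) * ecurrentSum K ({s} ∆ {t}) * ecurrentSum K ({t} ∆ {y}) +
            ecurrentSum K ({x} ∆ {t}) * ecurrentSum K ({t} ∆ {s}) * ecurrentSum K ({s} ∆ {y})) := by
  have hexp : ∀ p : Current G × Current G,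
      epairWeight K ({x} ∆ {y}) ∅ p *
          (∑ s ∈ T, (if s ∈ (p.1 + p.2).cluster x then (1 : ℝ≥0∞) else 0)) ^ 2 =
        ∑ s ∈ T, ∑ t ∈ T, epairWeight K ({x} ∆ {y}) ∅ p *
          ((if s ∈ (p.1 + p.2).cluster x then (1 : ℝ≥0∞) else 0) *
            (if t ∈ (p.1 + p.2).cluster x then (1 : ℝ≥0∞) else 0)) := by
    intro p
    rw [sq, Finset.sum_mul_sum, Finset.mul_sum]
    refine Finset.sum_congr rfl fun s _ => ?_
    rw [Finset.mul_sum]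
  rw [tsum_congr hexp, Summable.tsum_finsetSum (fun _ _ => ENNReal.summable), Finset.mul_sum]
  refine Finset.sum_le_sum fun s _ => ?_
  rw [Summable.tsum_finsetSum (fun _ _ => ENNReal.summable), Finset.mul_sum]
  refine Finset.sum_le_sum fun t _ => ?_
  rw [add_comm]
  exact Current.ecurrentSum_empty_mul_tsum_double_conn_le hK x y s t

end HittingBound

open HittingBound in
/-- **The hitting engine (H)** — Paley–Zygmund for the duplicated cluster against a deterministic
obstacle, finite graphs, couplings `K ≥ 0`: with `Z[A] = ecurrentSum K A`, `C(x) = C_{n₁+n₂}(x)` under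
the pair weights `1{∂n₁={x,y}}1{∂n₂=∅} w w` and `B(s,t) = Z[xs]Z[st]Z[ty] + Z[xt]Z[ts]Z[sy]`,
`(Σ_{s∈T} Z[xs]Z[sy])² · Z[∅] ≤ (Σ_{s,t∈T} B(s,t)) · Σ 1{∂n₁={x,y}}1{∂n₂=∅} w w 𝟙[C(x) ∩ T ≠ ∅]`
(first moment: one-point identity; second moment: Prop. A.3; Cauchy–Schwarz).
[cite: AizenmanDuminilCopinAnnals2021, arXiv:1912.07973 §4.2, proof of Lemma 4.4 (second-moment inequality)] -/
theorem stub_hittingBound : HittingLowerBound := by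
  intro V _ _ G _ K hK x y T
  have hCS := Current.tsum_mul_sq_le_tsum_indicator_mul_tsum_sq (epairWeight K ({x} ∆ {y}) ∅)
    (fun p : Current G × Current G => ∑ s ∈ T, (if s ∈ (p.1 + p.2).cluster x then (1 : ℝ≥0∞) else 0))
  simp only [tsum_epairWeight_mul_count hK x y T, indicator_count_ne_zero x T] at hCS
  calc (∑ s ∈ T, ecurrentSum K ({x} ∆ {s}) * ecurrentSum K ({s} ∆ {y})) ^ 2 * ecurrentSum K ∅
      ≤ ((∑' p : Current G × Current G, epairWeight K ({x} ∆ {y}) ∅ p *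
            (if Disjoint T ((p.1 + p.2).cluster x) then 0 else 1)) *
          ∑' p : Current G × Current G, epairWeight K ({x} ∆ {y}) ∅ p *
            (∑ s ∈ T, (if s ∈ (p.1 + p.2).cluster x then (1 : ℝ≥0∞) else 0)) ^ 2) *
          ecurrentSum K ∅ := mul_le_mul' hCS le_rfl
    _ = (∑' p : Current G × Current G, epairWeight K ({x} ∆ {y}) ∅ p *
            (if Disjoint T ((p.1 + p.2).cluster x) then 0 else 1)) *
          (ecurrentSum K ∅ * ∑' p : Current G × Current G, epairWeight K ({x} ∆ {y}) ∅ p *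
            (∑ s ∈ T, (if s ∈ (p.1 + p.2).cluster x then (1 : ℝ≥0∞) else 0)) ^ 2) := by ring
    _ ≤ (∑' p : Current G × Current G, epairWeight K ({x} ∆ {y}) ∅ p *
            (if Disjoint T ((p.1 + p.2).cluster x) then 0 else 1)) *
          ∑ s ∈ T, ∑ t ∈ T,
            (ecurrentSum K ({x} ∆ {s}) * ecurrentSum K ({s} ∆ {t}) * ecurrentSum K ({t} ∆ {y}) +
              ecurrentSum K ({x} ∆ {t}) * ecurrentSum K ({t} ∆ {s}) * ecurrentSum K ({s} ∆ {y})) :=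
        mul_le_mul' le_rfl (ecurrentSum_empty_mul_tsum_epairWeight_mul_count_sq_le hK x y T)
    _ = _ := mul_comm _ _

end Summit.CriticalPhenomena.Ising3DConformalLimit.EnergyNotSigmaSquaredGapForcesFarMerging

end
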